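import Summits.BirchSwinnertonDyer.BirchSwinnertonDyer.Theorems.AdditiveKolyvaginRoadEigen
import Summits.BirchSwinnertonDyer.BirchSwinnertonDyer.Theorems.AdditiveKolyvaginRoadVisibleCoreBricks
import Literature.NumberTheory.EllipticCurves.BSDRankZeroDensityProofs
import Literature.NumberTheory.EllipticCurves.BSDSelmerCMPConverseHeegnerFieldProofs
import Literature.NumberTheory.EllipticCurves.BSDSelmerParityDokchitserProofs
import Literature.NumberTheory.EllipticCurves.NonEisensteinPrimeOfSurjective
import Literature.NumberTheory.EllipticCurves.BSDSha
import HarnessLib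

/-!
# Line `admdef` v7, cell β: the (Par) stub text `OddSelmerDimBeta` («`dim_𝔽p Sel_p(E/K)⁺ + dim_𝔽p Sel_p(E/K)⁻` is ODD») DERIVED
# from two typed named facts — Cassels–Tate and Dokchitser–Dokchitser 2010 §4.6 step (4) — by kernel glue
# (crux `AnticyclotomicEisensteinDivisibility`, stmt-BirchSwinnertonDyer-20727; LEAD seat bsd-line-sbc-p1 gen 17,
# `--supports stmt-BirchSwinnertonDyer-20727`)

WHY THIS FILE.  Skeleton v7 of `Cruxes/AnticyclotomicEisensteinDivisibility/Lines/admdef.lean` (428d042669deeba3) carries the registered stub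
`stub_oddSelmerDim : OddSelmerDimBeta` — (Par): for `(N : ℤ) = N_E`, `p ≥ 5`, `ρ̄_{E,p}` onto, `K` imaginary quadratic, every `ℓ ∣ N` split in `K`,
`c ∈ Aut(K/ℚ)`, `c ≠ 1`, any `𝔽_p`-structure on `H¹(K, E[p])`: `Odd (finrank (SelQP W K p c ∅ true) + finrank (SelQP W K p c ∅ false))`.  THIS FILE
proves that text from the TWO typed Literature named facts it rests on in print, so that the stub can be replaced by two CITE conjuncts:
* `WeierstrassCurve.exists_casselsTate_pairing` (Cassels 1962 ∕ Tate 1963: the alternating pairing on `Ш(E/K)` with kernel the divisible part) —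
  through the tree theorem `WeierstrassCurve.exists_selmerRank_eq_add` (`#Sel_p = p^s`, `#E(K)[p] = p^t` ⇒ `s = t + rk_p + 2m`);
* `dokchitser_selmerCorank_baseChange_mod_two_eq` (Dokchitser–Dokchitser 2010, §4.6, proof of Thm 4.19 step (4): `rk_p(E/K)` is ODD for `K`
  imaginary quadratic in which every bad prime of `E` splits, `p` odd);
and the kernel dictionary: `#Sel_p(E/K) = p^(dim Sel_∅⁺ + dim Sel_∅⁻)` (AKR `natCard_selmer_eq_pow_finrank_selQP_add`, eigen-decomposition under
complex conjugation for `p` odd), `E(K)[p] = 0` (`ρ̄` onto ⟹ irreducible, `torsionBy_eq_bot_of_isImaginaryQuadratic_of_hasIrreducibleModPGaloisRep`),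
`c² = 1` (`Aut(K/ℚ)` has order two).

WHAT IS PROVED (kernel; no definition, no named fact, no `sorry`): `oddSelmerDim_of_casselsTate_of_dokchitser` — the text of `OddSelmerDimBeta`
VERBATIM from the two facts.  CONDITIONAL on them (audit `proof.conditional`); nothing about BSD / the crux / (Anch) is asserted.

References: [cite: DokchitserDokchitserAnnals2010, §4.6, Thm. 4.19 (= Thm. 1.4), pp. 26–27] [cite: SilvermanAEC2009, Thm. X.4.2, Thm. X.4.14]
[cite: Dokchitser2013ParityNotes, §2] [cite: GrossLMS1991, §5 (5.1), §10] [cite: WZhang2014, Thm. 9.2 (m = 1)].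
-/

-- D-0017: single-problem summit, the namespace repeats the problem name by design.
set_option linter.dupNamespace false
set_option autoImplicit false

noncomputable section

open scoped Classical NumberField AddSubgroup

namespace Summit.BirchSwinnertonDyer.BirchSwinnertonDyer.Theorems.SignedBaseChangeAcDivAdmdefOddSelmerDim

open WeierstrassCurve NumberField IsDedekindDomain Field Module
  Literature.NumberTheory.EllipticCurves Literature.NumberTheory.EllipticCurves.Rank1Residual
  Literature.NumberTheory.GaloisRepresentations
  Summit.BirchSwinnertonDyer.BirchSwinnertonDyer.Theorems Summit.BirchSwinnertonDyer.BirchSwinnertonDyer.Theorems.AdditiveKoly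

/-- In a quadratic field, a non-trivial automorphism is an involution (`#Aut(K/ℚ) ≤ 2`; AKR `algEquiv_eq_one_or_eq_of_finrank_two`). [folklore] -/
theorem algEquiv_mul_self_eq_one_of_ne_one {K : Type} [Field K] [NumberField K] (h2 : Module.finrank ℚ K = 2)
    {c : K ≃ₐ[ℚ] K} (hc1 : c ≠ 1) : c * c = 1 :=
  (algEquiv_eq_one_or_eq_of_finrank_two h2 hc1 (c * c)).elim id
    fun h ↦ absurd (mul_left_cancel (h.trans (mul_one c).symm)) hc1

/-- **(Par) — `OddSelmerDimBeta` from Cassels–Tate and Dokchitser–Dokchitser 2010 §4.6 step (4).**  For `(N : ℤ) = N_E`, `p ≥ 5`, `ρ̄_{E,p}` onto, `K`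
imaginary quadratic with every `ℓ ∣ N` split, `c ≠ 1` in `Aut(K/ℚ)` and any `𝔽_p`-structure on `H¹(K, E[p])`: `dim_𝔽p Sel_∅⁺ + dim_𝔽p Sel_∅⁻` is odd
(`Sel_∅^μ = AdditiveKoly.SelQP W K p c ∅ μ`).  Proof: `#Sel_p(E/K) = p^(dim Sel_∅⁺ + dim Sel_∅⁻)` (eigen-decomposition, `p` odd, `c² = 1`); `E(K)[p] = 0`
(`ρ̄` onto ⟹ `E[p]` irreducible; a `K`-rational `p`-torsion point over a quadratic field would give a `Γ_ℚ`-stable line or make `ρ̄` small); hence by the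
Cassels–Tate count `dim Sel_p = 0 + rk_p(E/K) + 2m` (`exists_selmerRank_eq_add`); and `rk_p(E/K)` is odd (DD10 step (4), Heegner hypothesis from the
binder `(N : ℤ) = N_E`).  The statement is the v7 stub text VERBATIM. [cite: DokchitserDokchitserAnnals2010, §4.6, Thm. 4.19, pp. 26–27]
[cite: SilvermanAEC2009, Thm. X.4.14] [cite: Dokchitser2013ParityNotes, §2] -/
theorem oddSelmerDim_of_casselsTate_of_dokchitser
    (hCT : ∀ (K : Type) [Field K] [NumberField K], WeierstrassCurve.exists_casselsTate_pairing (K := K))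
    (hDD : dokchitser_selmerCorank_baseChange_mod_two_eq) :
    ∀ {p : ℕ} [Fact p.Prime] (W : WeierstrassCurve ℚ) [W.IsElliptic] [W.IsGloballyMinimal]
      (K : Type) [Field K] [NumberField K] {N : ℕ},
      (N : ℤ) = W.conductorNorm ℤ → 5 ≤ p → Surj W p → IsImaginaryQuadratic K →
      (∀ ℓ : ℕ, ℓ.Prime → ℓ ∣ N → ((Ideal.span {(ℓ : ℤ)}).primesOver (𝓞 K)).ncard = 2) →
      ∀ (c : K ≃ₐ[ℚ] K), c ≠ 1 → ∀ [Module (ZMod p) (AdditiveKoly.Vp W K p)],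
        Odd (Module.finrank (ZMod p) (AdditiveKoly.SelQP W K p c ∅ true) +
          Module.finrank (ZMod p) (AdditiveKoly.SelQP W K p c ∅ false)) := by
  intro p _ W _ _ K _ _ N hN h5 hsurj hK hHeeg c hc1 _
  have hp : p.Prime := Fact.out
  have hp2 : p ≠ 2 := by omega
  have hN' : N = W.conductorNorm ℤ := by exact_mod_cast hN
  have hH : SatisfiesHeegnerHypothesis (W.conductorNorm ℤ) K := fun ℓ hℓ hℓN ↦ hHeeg ℓ hℓ (hN' ▸ hℓN)
  have hcc : c * c = 1 := algEquiv_mul_self_eq_one_of_ne_one hK.1 hc1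
  -- `#Sel_p(E/K) = p ^ s`, `s = dim Sel⁺ + dim Sel⁻`
  set s := Module.finrank (ZMod p) (SelQP W K p c ∅ true) + Module.finrank (ZMod p) (SelQP W K p c ∅ false) with hs_def
  have hs : Nat.card (selmerGroup (W.baseChange K) ((p ^ 1 : ℕ) : ℤ)) = p ^ s :=
    natCard_selmer_eq_pow_finrank_selQP_add W K p hp2 hK c hcc
  have hs' : Nat.card ((W.baseChange K).selmerGroup p) = p ^ s := by
    have e : ((p ^ 1 : ℕ) : ℤ) = (p : ℤ) := by simp
    rw [e] at hs
    exact hs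
  -- `E(K)[p] = 0`
  haveI : NeZero (p : ℚ) := ⟨Nat.cast_ne_zero.mpr hp.ne_zero⟩
  have hirr : W.HasIrreducibleModPGaloisRep p := hasIrreducibleModPGaloisRep_of_hasSurjectiveModNGaloisRep W p hsurj
  have ht : Nat.card ((W.baseChange K).toAffine.Point[(p : ℤ)]) = p ^ 0 := by
    rw [torsionBy_eq_bot_of_isImaginaryQuadratic_of_hasIrreducibleModPGaloisRep W K hK hp hirr, pow_zero,
      AddSubgroup.card_bot]
  -- Cassels–Tate count and the Dokchitser parity
  obtain ⟨m, hm⟩ := exists_selmerRank_eq_add (hCT K) (W.baseChange K) p s 0 hs' ht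
  have hodd : Odd ((W.baseChange K).selmerCorank p) :=
    dokchitser_selmerCorank_baseChange_mod_two_eq.odd hDD W p hp2 K hK hH
  rw [hm, zero_add]
  exact hodd.add_even (even_two_mul m)

end Summit.BirchSwinnertonDyer.BirchSwinnertonDyer.Theorems.SignedBaseChangeAcDivAdmdefOddSelmerDim

end
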